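import Literature.NumberTheory.IwasawaTheory.ClassicalMuVanishesSplitCartanFiveImageAbelian
import Literature.NumberTheory.EllipticCurves.FineSelmerClassGroupCriterionThm34Proofs
import HarnessLib

set_option autoImplicit false

/-!
# Statement (A) at `p = 5` on the split-Cartan-normaliser rows with NO named fact: Ferrero–Washington replaced by the three abelian
# leaves `K′`, `ℚ(ζ₅)`, `Q₂` of `ℚ(E[5])`

Topic `NumberTheory/EllipticCurves`; THEOREM-ONLY file (no definition, no named fact, no `sorry`), written by the prover seat
`bsd-potss-k8t-c4` g24 (cell `bsd-potss`; supports the KT fine-Selmer residue crux stmt-BirchSwinnertonDyer-19916 — whose `p = 5`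
census residue row 283200gf1 is a `5Ns` row — and the U₀ parent stmt-BirchSwinnertonDyer-19982; closes nothing).  Twin of
`FineSelmerMuRoadSplitCartanFive.fineSelmerDual_moduleFinite_of_splitCartanBasis_five` (conjA-anchor g11: modulo `hCS` + `hFW`) with
BOTH named facts gone: Coates–Sujatha Thm. 3.4 is the tree theorem `thm34_…_holds` (k8t-c4 g22) and Ferrero–Washington is replaced —
by the character count of `ClassicalMuVanishesSplitCartanFiveDescentAbelian` (k8t-c4 g24) — by «`μ = 0` for every cyclotomic
`ℤ_5`-extension» of the three ABELIAN fixed fields `K′ = ℚ(E[5])^⟨σ̄_uσ̄_v⁻¹, σ̄_w⟩` (cyclic quartic `⊇ ℚ(√5)`),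
`Z = ℚ(E[5])^⟨σ̄_uσ̄_v⁻¹, σ̄_u²σ̄_w⟩` (`= ℚ(ζ₅)`) and `Q₂ = ℚ(E[5])^⟨σ̄_uσ̄_v⁻¹, σ̄_wσ̄_u⟩` (`= ℚ(√(5d₁))`), inputs a finite
class-group computation certifies (Iwasawa 1956 / Fukuda 1994, tree theorems).  The leaf `ℚ(x P₁) ⊆ ℚ(P₁)` of g11 is dropped
(`p`-prime-index descent).

References: [CoatesSujatha2005] Thm. 3.4; [Washington1997] §13.1; [Serre1972] §2.2; [Lemmermeyer1994] §1.
-/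

noncomputable section

open scoped NumberField Matrix

open Field IntermediateField WeierstrassCurve Literature.NumberTheory.EllipticCurves Literature.NumberTheory.GaloisRepresentations
  Literature.NumberTheory.SerreUniformity Literature.NumberTheory.IwasawaTheory

namespace Literature.NumberTheory.EllipticCurves.CoatesSujatha2005

/-- **Statement (A) at `5` for a split-Cartan-normaliser basis (`5Ns`), NO named fact.**  `E/ℚ` elliptic; `e` a basis of `E[5]`
in which every `σ ∈ Γ_ℚ` acts through `splitCartanNormalizer 5`; `σ_u, σ_v, σ_w ∈ Γ_ℚ` acting as `diag(2,1)`, `diag(1,2)`,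
`(0 1; 1 0)`; `μ = 0` (growth form) for every cyclotomic `ℤ_5`-extension of the fixed fields in `ℚ(E[5])` of `⟨σ̄_v⟩` (`= ℚ(P₁)`, 8),
`⟨σ̄_u²σ̄_v⟩` (8), `⟨σ̄_uσ̄_v, σ̄_w⟩` (`= ℚ(⟨P₁+P₂⟩)`, 4), `⟨σ̄_uσ̄_v⁻¹, σ̄_w⟩` (`K′`, 4), `⟨σ̄_uσ̄_v⁻¹, σ̄_u²σ̄_w⟩` (`= ℚ(ζ₅)`, 4),
`⟨σ̄_uσ̄_v⁻¹, σ̄_wσ̄_u⟩` (`Q₂`, 2); then the dual fine Selmer group of `E` over `ℚ_cyc` is finitely generated over `ℤ_5`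
(Coates–Sujatha Thm. 3.4, PROVED in the tree, ∘ `classicalMuVanishes_divisionField_of_splitCartanBasis_five_abelian`).
[cite: CoatesSujatha2005, Thm. 3.4 (§3)] [cite: Washington1997, §13.1] [cite: Serre1972, §2.2 (split Cartan subgroups, normalisers)]
[cite: Lemmermeyer1994, §1 (Kuroda's class number formula, odd part)] -/
theorem fineSelmerDual_moduleFinite_of_splitCartanBasis_five_abelian [Fact (Nat.Prime 5)] (W : WeierstrassCurve ℚ) [W.IsElliptic]
    (e : W.geomTorsion (5 : ℕ) ≃+ (Fin 2 → ZMod 5))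
    (he : ∀ σ : absoluteGaloisGroup ℚ, ∃ M ∈ splitCartanNormalizer 5, ∀ P : W.geomTorsion (5 : ℕ), e (σ • P) = M *ᵥ e P)
    (σu σv σw : absoluteGaloisGroup ℚ) (hσu : ∀ P : W.geomTorsion (5 : ℕ), e (σu • P) = !![2, 0; 0, 1] *ᵥ e P)
    (hσv : ∀ P : W.geomTorsion (5 : ℕ), e (σv • P) = !![1, 0; 0, 2] *ᵥ e P)
    (hσw : ∀ P : W.geomTorsion (5 : ℕ), e (σw • P) = !![0, 1; 1, 0] *ᵥ e P)
    (hμP : ∀ κE : ZpExtension ↥(fixedField (Subgroup.zpowers (absRestrictNormalHom (W.divisionField 5) σv))) 5,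
      κE.IsCyclotomic → ClassicalMuVanishes κE)
    (hμD : ∀ κE : ZpExtension ↥(fixedField (Subgroup.zpowers (absRestrictNormalHom (W.divisionField 5) σu *
        absRestrictNormalHom (W.divisionField 5) σu * absRestrictNormalHom (W.divisionField 5) σv))) 5,
      κE.IsCyclotomic → ClassicalMuVanishes κE)
    (hμC : ∀ κE : ZpExtension ↥(fixedField (Subgroup.zpowers (absRestrictNormalHom (W.divisionField 5) σu *
        absRestrictNormalHom (W.divisionField 5) σv) ⊔ Subgroup.zpowers (absRestrictNormalHom (W.divisionField 5) σw))) 5,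
      κE.IsCyclotomic → ClassicalMuVanishes κE)
    (hμK : ∀ κE : ZpExtension ↥(fixedField (Subgroup.zpowers (absRestrictNormalHom (W.divisionField 5) σu *
        (absRestrictNormalHom (W.divisionField 5) σv)⁻¹) ⊔ Subgroup.zpowers (absRestrictNormalHom (W.divisionField 5) σw))) 5,
      κE.IsCyclotomic → ClassicalMuVanishes κE)
    (hμZ : ∀ κE : ZpExtension ↥(fixedField (Subgroup.zpowers (absRestrictNormalHom (W.divisionField 5) σu *
        (absRestrictNormalHom (W.divisionField 5) σv)⁻¹) ⊔ Subgroup.zpowers (absRestrictNormalHom (W.divisionField 5) σu *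
        absRestrictNormalHom (W.divisionField 5) σu * absRestrictNormalHom (W.divisionField 5) σw))) 5,
      κE.IsCyclotomic → ClassicalMuVanishes κE)
    (hμQ : ∀ κE : ZpExtension ↥(fixedField (Subgroup.zpowers (absRestrictNormalHom (W.divisionField 5) σu *
        (absRestrictNormalHom (W.divisionField 5) σv)⁻¹) ⊔ Subgroup.zpowers (absRestrictNormalHom (W.divisionField 5) σw *
        absRestrictNormalHom (W.divisionField 5) σu))) 5,
      κE.IsCyclotomic → ClassicalMuVanishes κE)
    (κ : ZpExtension ℚ 5) (hκ : κ.IsCyclotomic) :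
    ∃ (γ : absoluteGaloisGroup ℚ) (D : W.FineSelmerDualData κ γ), Module.Finite ℤ_[5] (RestrictScalars ℤ_[5] (IwasawaAlgebra 5) D.X) :=
  thm34_fineSelmerDual_moduleFinite_of_classicalMuVanishes_divisionField_holds W 5 (by decide)
    (classicalMuVanishes_divisionField_of_splitCartanBasis_five_abelian W e he σu σv σw hσu hσv hσw hμP hμD hμC hμK hμZ hμQ) κ hκ

end Literature.NumberTheory.EllipticCurves.CoatesSujatha2005

end
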